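import Summits.BirchSwinnertonDyer.BirchSwinnertonDyer.Theorems.AdditiveRankOneBSDpRowKernels
import Summits.BirchSwinnertonDyer.BirchSwinnertonDyer.Theorems.AdditivePotSupersingularControlOfFacts
import HarnessLib

/-!
# BSD_p in analytic rank ONE at an additive potentially SUPERSINGULAR prime — ANY odd `p`, tame or wild — with the
# local step DISCHARGED: `BSD_p(E)` ⟸ the ♭-(∅,0)-main-conjecture equality at `(E, p)` (or: its Eisenstein inclusion +
# a Kolyvagin index bound) + `BSD_p` of the rank-zero twist + published facts
# (row B8 «O7-ss» of the programme; K9 19200 `WildRankOne` / KT 19984 `TameRankOne`)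

Prover seat `bsd-potss-kmc`, gen 20 (cell `bsd-potss`), 2026-08-27. HONEST FRAMING: theorems CONDITIONAL on every
displayed hypothesis; 0 definitions, 0 named facts minted, 0 `sorry`; closes nothing; BSD_p for no curve.

On the potentially SUPERSINGULAR rows — `ClassO5 W p ∨ ClassO6 W p` (tame `(t′) ∪ (G)∧ss` at any odd `p`, or wild `3`) —
with `ρ̄_{E,p}` IRREDUCIBLE (all X4 rows, surjective image or not), exact anticyclotomic control is NOT a hypothesis any
more: it is gen 20's `AdditivePotSupersingularControl.additiveControl_heegner_potSS_of_facts_of_serre1967` (the generic K1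
doors + Brink + Serre 1967 §5 Prop 8). Feeding it to the row-local kernels of `Theorems/AdditiveRankOneBSDpRowKernels.lean`:

* §1 **`bsdp_potSS_of_flatIMCEq_of_twist_of_facts`** `(p) (R)` — for any row predicate `R` (e.g. `⊤`, tower
  surjectivity, a twin condition): on the rows `R W ∧ (ClassO5 W p ∨ ClassO6 W p) ∧ ρ̄ irreducible ∧ r_an = 1`,
  `BSD_p(W)` ⟸ Hsieh ∧ LZZ ∧ ToricPublishedInputs ∧ {Poitou–Tate ×2, local Euler–Poincaré, cd ≤ 2, Brink Thm 2 / Cor 1,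
  Serre 1967} ∧ `hEq` (the ♭-IMC equality on the class rows — RESEARCH) ∧ `hTw` (`BSD_p` of the rank-zero twists of class
  rows — the r = 0 leaf).
* §2 **`bsdp_potSS_of_flatEisenstein_of_kolyvagin_of_twist_of_facts`** `(p) (R)` — the same with `hEq` replaced by the
  Eisenstein ♭-inclusion `hIncl` (X) and a Manin-robust Kolyvagin index bound `hKo` (route SOED's shape, generic `p`).
* §3 `missingPPartAt_potSS_…` — both in the residuals' currency `MissingPPartAt W p` (`Ш(E/ℚ)` finite by GZK), and the
  two residual cells by name: `missingPPartAt_tameRankOne_of_flatIMCEq_of_twist_of_facts` (KT 19984's binders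
  `r_an = 1 → p ≠ 2 → Addv W p → SubTprime W p`, plus `ρ̄` irreducible and `R`) and
  `missingPPartAt_wildRankOne_of_flatIMCEq_of_twist_of_facts` (K9 19200's binders `r_an = 1 → ClassO6 W 3`, plus the same).

NET (row B8 / O7-ss, «the emptiest cell of the map»): at every odd additive potentially supersingular prime of an X4 curve
of analytic rank one, `BSD_p` needs beyond PRINT exactly (a) the (∅,0) anticyclotomic main conjecture for `f_E` at the
additive split prime in the ♭-currency — as an EQUALITY, or as its Eisenstein inclusion plus a Kolyvagin–Jetchev index
bound — (RESEARCH; UTD #2/#3, SOED X ∧ J, K1 H3 are its faces at `3`) and (b) `BSD_p` of the rank-ZERO twist (the r = 0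
leaf of the same class) — nothing local at `p`, no `p`-adic height, no signed Selmer condition.

References: [JetchevSkinnerWan2017] §7.4.1, Thm. 3.3.1; [Castella2018] Thm 2.3; [Hsieh2014] Thm A; [LiuZhangZhang2018]
Thm 1.5.1/1.5.3; [Brink2007] Thm 2, Cor 1; [Serre1967GroupesPDivisibles] §5 Prop. 8; [MilneADT2006] I 2.8, 4.10;
[Kolyvagin1990] Thm. A; [Jetchev2008] Thm 1.4; [FriedbergHoffstein1995] Thm. B.
-/

noncomputable section

open scoped Classical

set_option linter.dupNamespace false
set_option autoImplicit false

namespace Summit.BirchSwinnertonDyer.BirchSwinnertonDyer.Theorems.UniversalToricDescentWaldspurgerFlat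

open WeierstrassCurve NumberField IsDedekindDomain Field PowerSeries
  Literature.NumberTheory.EllipticCurves
  Literature.NumberTheory.EllipticCurves.ModularForms
  Literature.NumberTheory.EllipticCurves.Rank1Residual
  Literature.NumberTheory.EllipticCurves.Rank1Residual.Typed
  Literature.NumberTheory.EllipticCurves.KrizLi2019
  Literature.NumberTheory.GaloisRepresentations
  Literature.NumberTheory.GaloisCohomology
  Summit.BirchSwinnertonDyer.Rank1Residual
  Summit.BirchSwinnertonDyer.Rank1Residual.Additive
  Summit.BirchSwinnertonDyer.Rank1Residual.X11b
  Summit.BirchSwinnertonDyer.Rank1Residual.X11b.AcSelmer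
  Summit.BirchSwinnertonDyer.Rank1Residual.X11b.Halves
  Summit.BirchSwinnertonDyer.Rank1Residual.X11b.CongruenceLimit
  Summit.BirchSwinnertonDyer.BirchSwinnertonDyer.Theses.UniversalToricDescent
  Summit.BirchSwinnertonDyer.BirchSwinnertonDyer.Theorems.AdditivePotSupersingularControl

section PotSS

variable (p : ℕ) [Fact p.Prime] (R : WeierstrassCurve ℚ → Prop)

/-! ## §1 ♭-IMC equality + rank-zero twist, control discharged -/

/-- **`BSD_p` in analytic rank one at EVERY odd additive potentially SUPERSINGULAR prime of an X4 curve, local step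
DISCHARGED.** For any row predicate `R`: on the rows `R W`, `ClassO5 W p ∨ ClassO6 W p`, `ρ̄_{E,p}` irreducible,
`r_an(E) = 1`: `BSD_p(E)` from Hsieh 2014 Thm A, Liu–Zhang–Zhang 2018, the route's published inputs, the seven cohomological
named facts, and TWO class-row hypotheses: `hEq` the ♭-(∅,0)-IMC equality at every Heegner datum and anticyclotomic frame of
a class row (RESEARCH-GRADE), and `hTw` `BSD_p` of globally minimal models of the rank-zero twists `E^{(d_K)}` of class rows.
Exact anticyclotomic control is supplied by `additiveControl_heegner_potSS_of_facts_of_serre1967`. CONDITIONAL; closes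
nothing; BSD_p for no curve.
[cite: JetchevSkinnerWan2017, §7.4.1 and Thm. 3.3.1 (arXiv:1512.06894)] [cite: Hsieh2014, Thm. A p. 712 (Doc. Math. 19)]
[cite: LiuZhangZhang2018, Thm 1.5.1 and Thm 1.5.3 (Duke Math. J. 167 pp. 748–749)] [cite: Brink2007, Thm. 2 and Cor. 1]
[cite: Serre1967GroupesPDivisibles, §5 Prop. 8] [cite: FriedbergHoffstein1995, Thm. B] -/
theorem bsdp_potSS_of_flatIMCEq_of_twist_of_facts
    (hA : Hsieh2014.thmA_exists_isHsiehLFunction_unrPeriod_anyLevel)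
    (hL : LiuZhangZhang2018.thm151_thm153_modularCurve_heegnerVector_additive)
    (hF : ToricPublishedInputs)
    (hPT : ∀ (K : Type) [Field K] [NumberField K], poitouTate_selmerStructure_duality K)
    (hPT2 : ∀ (K : Type) [Field K] [NumberField K], poitouTate_sha_tateDual K)
    (hEP : ∀ (K : Type) [Field K] [NumberField K] (v : HeightOneSpectrum (𝓞 K)),
      localEulerPoincareCharacteristic (v.adicCompletion K))
    (hcd : fieldCdLE_two_of_numberField)
    (hBr : ∀ (K : Type) [Field K] [NumberField K] (p : ℕ) [Fact p.Prime],
      ZpExtension.decomp_not_le_kerSubgroup_of_isAnticyclotomic K p)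
    (hBr2 : ∀ (K : Type) [Field K] [NumberField K] (p : ℕ) [Fact p.Prime],
      ZpExtension.decomp_not_le_kerSubgroup_above_of_isAnticyclotomic K p)
    (hS : Serre1967.noStableDivisibleLine_of_potentiallySupersingular)
    (hEq : ∀ (W : WeierstrassCurve ℚ) [W.IsElliptic] [W.IsGloballyMinimal] (N : ℕ) [NeZero N] (K : Type) [Field K]
      [NumberField K] (Dt : ModularParametrizationData W N),
      R W → (ClassO5 W p ∨ ClassO6 W p) → W.HasIrreducibleModPGaloisRep p → W.analyticRank = 1 → W.conductorNorm ℤ = N →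
      IsImaginaryQuadratic K → SatisfiesHeegnerHypothesis N K →
      ∀ (κ : ZpExtension K p), κ.IsAnticyclotomic → ∀ (γ : Field.absoluteGaloisGroup K) [Fact (κ.IsTopGenerator γ)]
        (𝔭 : HeightOneSpectrum (𝓞 K)), ((p : ℕ) : 𝓞 K) ∈ 𝔭.asIdeal → 𝔭.asIdeal.ramificationIdx (𝓞 ℚ) = 1 →
        𝔭.asIdeal.inertiaDeg (𝓞 ℚ) = 1 → ∀ (𝔭' : HeightOneSpectrum (𝓞 K)), ((p : ℕ) : 𝓞 K) ∈ 𝔭'.asIdeal → 𝔭' ≠ 𝔭 →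
        ∀ (ι' : PadicAlgCl p ≃+* ℂ), SchneiderFree.BranchInducesPrime p ι' 𝔭 →
        ∀ (ΩK : ℂ) (Ωp : ℂ_[p]) (Q : PowerSeries (PadicComplexInt p)), ΩK ≠ 0 → Ωp ≠ 0 →
          R1.IsBDPLFunctionInt p ι' 𝔭 κ γ Dt.f ΩK Ωp Q →
          (XAc.charIdeal (W.baseChange K) p κ 𝔭' ∅ γ).map (PowerSeries.map (R1.toCpInt p)) = Ideal.span {Q})
    (hTw : ∀ (W : WeierstrassCurve ℚ) [W.IsElliptic] [W.IsGloballyMinimal] (N : ℕ) [NeZero N] (K : Type) [Field K]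
      [NumberField K] (Wd : WeierstrassCurve ℚ) [Wd.IsElliptic] [Wd.IsGloballyMinimal],
      R W → (ClassO5 W p ∨ ClassO6 W p) → W.HasIrreducibleModPGaloisRep p → W.analyticRank = 1 → W.conductorNorm ℤ = N →
      IsImaginaryQuadratic K → SatisfiesHeegnerHypothesis N K →
      (∃ C : VariableChange ℚ, C • W.quadraticTwist (NumberField.discr K : ℚ) = Wd) →
      (W.quadraticTwist (NumberField.discr K : ℚ)).entireLFunction 1 ≠ 0 → BSDp Wd p) :
    ∀ (W : WeierstrassCurve ℚ) [W.IsElliptic] [W.IsGloballyMinimal],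
      R W → (ClassO5 W p ∨ ClassO6 W p) → W.HasIrreducibleModPGaloisRep p → W.analyticRank = 1 → BSDp W p := by
  intro W _ _ hR hcls hirr hr
  have hp2 : p ≠ 2 := hcls.elim (fun h ↦ h.1) (fun h ↦ h.1)
  have haddv : Addv W p := hcls.elim (fun h ↦ h.2.1) (fun h ↦ h.2.1)
  exact bsdp_of_flatIMCEq_of_control_of_twist_row p hp2 hA hL hF W haddv hr
    (fun N _ K _ _ Dt hN hK hHN κ hκ γ _ 𝔭 h𝔭 he hf 𝔭' h𝔭' hne ι' hind ΩK Ωp Q hΩK hΩp hBDP ↦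
      hEq W N K Dt hR hcls hirr hr hN hK hHN κ hκ γ 𝔭 h𝔭 he hf 𝔭' h𝔭' hne ι' hind ΩK Ωp Q hΩK hΩp hBDP)
    (fun N _ K _ _ Dt H ι P hN hK hHN _hLt hP hnt hKo κ hκ γ _ 𝔭 h𝔭 he hf ↦
      additiveControl_heegner_potSS_of_facts_of_serre1967 hPT hPT2 hEP hcd hBr hBr2 hS p W N K Dt H ι P hcls hirr
        hN hK hHN hP hnt hKo κ hκ γ 𝔭 h𝔭 he hf)
    (fun N _ K _ _ Wd _ _ hN hK hHN hC hLt ↦ hTw W N K Wd hR hcls hirr hr hN hK hHN hC hLt)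

/-! ## §2 Eisenstein ♭-inclusion + Kolyvagin bound + rank-zero twist, control discharged -/

/-- **`BSD_p` in analytic rank one at EVERY odd additive potentially SUPERSINGULAR prime of an X4 curve from the
EISENSTEIN ♭-inclusion and a KOLYVAGIN index bound, local step DISCHARGED** (route SOED's decomposition, generic `p`): as
`bsdp_potSS_of_flatIMCEq_of_twist_of_facts`, with the equality `hEq` replaced by (X) `hIncl`: `Ch_Λ(X_(∅,0) at 𝔭′)·𝓞_{ℂ_p}⟦T⟧
⊆ (Q)` at every class-row frame and (Ko) `hKo`: `Upper.IndexUpperBoundLeAt W p K P (v_p c)` at every class-row Heegner datum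
with `d_K` odd, `d_K < −4`, `L(E^{(d_K)},1) ≠ 0`, `P` the Heegner point of infinite order. CONDITIONAL; closes nothing.
[cite: JetchevSkinnerWan2017, §7.4.1 and Thm. 3.3.1 (arXiv:1512.06894)] [cite: Jetchev2008, Thm. 1.4 and Conj. 1.3]
[cite: Hsieh2014, Thm. A p. 712 (Doc. Math. 19)] [cite: LiuZhangZhang2018, Thm 1.5.1 and Thm 1.5.3 (Duke Math. J. 167 pp. 748–749)]
[cite: Brink2007, Thm. 2 and Cor. 1] [cite: Serre1967GroupesPDivisibles, §5 Prop. 8] -/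
theorem bsdp_potSS_of_flatEisenstein_of_kolyvagin_of_twist_of_facts
    (hA : Hsieh2014.thmA_exists_isHsiehLFunction_unrPeriod_anyLevel)
    (hL : LiuZhangZhang2018.thm151_thm153_modularCurve_heegnerVector_additive)
    (hF : ToricPublishedInputs)
    (hPT : ∀ (K : Type) [Field K] [NumberField K], poitouTate_selmerStructure_duality K)
    (hPT2 : ∀ (K : Type) [Field K] [NumberField K], poitouTate_sha_tateDual K)
    (hEP : ∀ (K : Type) [Field K] [NumberField K] (v : HeightOneSpectrum (𝓞 K)),
      localEulerPoincareCharacteristic (v.adicCompletion K))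
    (hcd : fieldCdLE_two_of_numberField)
    (hBr : ∀ (K : Type) [Field K] [NumberField K] (p : ℕ) [Fact p.Prime],
      ZpExtension.decomp_not_le_kerSubgroup_of_isAnticyclotomic K p)
    (hBr2 : ∀ (K : Type) [Field K] [NumberField K] (p : ℕ) [Fact p.Prime],
      ZpExtension.decomp_not_le_kerSubgroup_above_of_isAnticyclotomic K p)
    (hS : Serre1967.noStableDivisibleLine_of_potentiallySupersingular)
    (hIncl : ∀ (W : WeierstrassCurve ℚ) [W.IsElliptic] [W.IsGloballyMinimal] (N : ℕ) [NeZero N] (K : Type) [Field K]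
      [NumberField K] (Dt : ModularParametrizationData W N),
      R W → (ClassO5 W p ∨ ClassO6 W p) → W.HasIrreducibleModPGaloisRep p → W.analyticRank = 1 → W.conductorNorm ℤ = N →
      IsImaginaryQuadratic K → SatisfiesHeegnerHypothesis N K →
      ∀ (κ : ZpExtension K p), κ.IsAnticyclotomic → ∀ (γ : Field.absoluteGaloisGroup K) [Fact (κ.IsTopGenerator γ)]
        (𝔭 : HeightOneSpectrum (𝓞 K)), ((p : ℕ) : 𝓞 K) ∈ 𝔭.asIdeal → 𝔭.asIdeal.ramificationIdx (𝓞 ℚ) = 1 →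
        𝔭.asIdeal.inertiaDeg (𝓞 ℚ) = 1 → ∀ (𝔭' : HeightOneSpectrum (𝓞 K)), ((p : ℕ) : 𝓞 K) ∈ 𝔭'.asIdeal → 𝔭' ≠ 𝔭 →
        ∀ (ι' : PadicAlgCl p ≃+* ℂ), SchneiderFree.BranchInducesPrime p ι' 𝔭 →
        ∀ (ΩK : ℂ) (Ωp : ℂ_[p]) (Q : PowerSeries (PadicComplexInt p)), ΩK ≠ 0 → Ωp ≠ 0 →
          R1.IsBDPLFunctionInt p ι' 𝔭 κ γ Dt.f ΩK Ωp Q →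
          (XAc.charIdeal (W.baseChange K) p κ 𝔭' ∅ γ).map (PowerSeries.map (R1.toCpInt p)) ≤ Ideal.span {Q})
    (hKo : ∀ (W : WeierstrassCurve ℚ) [W.IsElliptic] [W.IsGloballyMinimal] (N : ℕ) [NeZero N] (K : Type) [Field K]
      [NumberField K] (Dt : ModularParametrizationData W N) (H : HeegnerDatum N (NumberField.discr K)) (ι : K →+* ℂ)
      (P : (W.baseChange K).toAffine.Point),
      R W → (ClassO5 W p ∨ ClassO6 W p) → W.HasIrreducibleModPGaloisRep p → W.analyticRank = 1 → W.conductorNorm ℤ = N →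
      IsImaginaryQuadratic K → SatisfiesHeegnerHypothesis N K → Odd (NumberField.discr K) → NumberField.discr K < -4 →
      (W.quadraticTwist (NumberField.discr K : ℚ)).entireLFunction 1 ≠ 0 →
      WeierstrassCurve.Affine.Point.map ι.toRatAlgHom P = heegnerPointComplex Dt H → ¬ IsOfFinAddOrder P →
      SchneiderFree.Upper.IndexUpperBoundLeAt W p K P (padicValNat p Dt.c.natAbs))
    (hTw : ∀ (W : WeierstrassCurve ℚ) [W.IsElliptic] [W.IsGloballyMinimal] (N : ℕ) [NeZero N] (K : Type) [Field K]
      [NumberField K] (Wd : WeierstrassCurve ℚ) [Wd.IsElliptic] [Wd.IsGloballyMinimal],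
      R W → (ClassO5 W p ∨ ClassO6 W p) → W.HasIrreducibleModPGaloisRep p → W.analyticRank = 1 → W.conductorNorm ℤ = N →
      IsImaginaryQuadratic K → SatisfiesHeegnerHypothesis N K →
      (∃ C : VariableChange ℚ, C • W.quadraticTwist (NumberField.discr K : ℚ) = Wd) →
      (W.quadraticTwist (NumberField.discr K : ℚ)).entireLFunction 1 ≠ 0 → BSDp Wd p) :
    ∀ (W : WeierstrassCurve ℚ) [W.IsElliptic] [W.IsGloballyMinimal],
      R W → (ClassO5 W p ∨ ClassO6 W p) → W.HasIrreducibleModPGaloisRep p → W.analyticRank = 1 → BSDp W p := by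
  intro W _ _ hR hcls hirr hr
  have hp2 : p ≠ 2 := hcls.elim (fun h ↦ h.1) (fun h ↦ h.1)
  have haddv : Addv W p := hcls.elim (fun h ↦ h.2.1) (fun h ↦ h.2.1)
  exact bsdp_of_flatEisenstein_of_kolyvagin_of_control_of_twist_row p hp2 hA hL hF W haddv hr
    (fun N _ K _ _ Dt hN hK hHN κ hκ γ _ 𝔭 h𝔭 he hf 𝔭' h𝔭' hne ι' hind ΩK Ωp Q hΩK hΩp hBDP ↦
      hIncl W N K Dt hR hcls hirr hr hN hK hHN κ hκ γ 𝔭 h𝔭 he hf 𝔭' h𝔭' hne ι' hind ΩK Ωp Q hΩK hΩp hBDP)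
    (fun N _ K _ _ Dt H ι P hN hK hHN hodd hd4 hLt hP hnt ↦
      hKo W N K Dt H ι P hR hcls hirr hr hN hK hHN hodd hd4 hLt hP hnt)
    (fun N _ K _ _ Dt H ι P hN hK hHN _hLt hP hnt hKo' κ hκ γ _ 𝔭 h𝔭 he hf ↦
      additiveControl_heegner_potSS_of_facts_of_serre1967 hPT hPT2 hEP hcd hBr hBr2 hS p W N K Dt H ι P hcls hirr
        hN hK hHN hP hnt hKo' κ hκ γ 𝔭 h𝔭 he hf)
    (fun N _ K _ _ Wd _ _ hN hK hHN hC hLt ↦ hTw W N K Wd hR hcls hirr hr hN hK hHN hC hLt)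

/-! ## §3 The residuals' currency and the two residual cells by name -/

/-- **The ♭-IMC-equality kernel in the residuals' currency `MissingPPartAt W p`** (both halves `ord_p #Ш = ord_p #Ш_an`;
`Ш(E/ℚ)` finite in analytic rank one by Gross–Zagier–Kolyvagin, a conjunct of `ToricPublishedInputs`). CONDITIONAL on the
hypotheses of `bsdp_potSS_of_flatIMCEq_of_twist_of_facts`; closes nothing.
[cite: JetchevSkinnerWan2017, §7.4.1 (arXiv:1512.06894 p. 30)] [cite: Serre1967GroupesPDivisibles, §5 Prop. 8] -/
theorem missingPPartAt_potSS_of_flatIMCEq_of_twist_of_facts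
    (hA : Hsieh2014.thmA_exists_isHsiehLFunction_unrPeriod_anyLevel)
    (hL : LiuZhangZhang2018.thm151_thm153_modularCurve_heegnerVector_additive)
    (hF : ToricPublishedInputs)
    (hPT : ∀ (K : Type) [Field K] [NumberField K], poitouTate_selmerStructure_duality K)
    (hPT2 : ∀ (K : Type) [Field K] [NumberField K], poitouTate_sha_tateDual K)
    (hEP : ∀ (K : Type) [Field K] [NumberField K] (v : HeightOneSpectrum (𝓞 K)),
      localEulerPoincareCharacteristic (v.adicCompletion K))
    (hcd : fieldCdLE_two_of_numberField)
    (hBr : ∀ (K : Type) [Field K] [NumberField K] (p : ℕ) [Fact p.Prime],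
      ZpExtension.decomp_not_le_kerSubgroup_of_isAnticyclotomic K p)
    (hBr2 : ∀ (K : Type) [Field K] [NumberField K] (p : ℕ) [Fact p.Prime],
      ZpExtension.decomp_not_le_kerSubgroup_above_of_isAnticyclotomic K p)
    (hS : Serre1967.noStableDivisibleLine_of_potentiallySupersingular)
    (hEq : ∀ (W : WeierstrassCurve ℚ) [W.IsElliptic] [W.IsGloballyMinimal] (N : ℕ) [NeZero N] (K : Type) [Field K]
      [NumberField K] (Dt : ModularParametrizationData W N),
      R W → (ClassO5 W p ∨ ClassO6 W p) → W.HasIrreducibleModPGaloisRep p → W.analyticRank = 1 → W.conductorNorm ℤ = N →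
      IsImaginaryQuadratic K → SatisfiesHeegnerHypothesis N K →
      ∀ (κ : ZpExtension K p), κ.IsAnticyclotomic → ∀ (γ : Field.absoluteGaloisGroup K) [Fact (κ.IsTopGenerator γ)]
        (𝔭 : HeightOneSpectrum (𝓞 K)), ((p : ℕ) : 𝓞 K) ∈ 𝔭.asIdeal → 𝔭.asIdeal.ramificationIdx (𝓞 ℚ) = 1 →
        𝔭.asIdeal.inertiaDeg (𝓞 ℚ) = 1 → ∀ (𝔭' : HeightOneSpectrum (𝓞 K)), ((p : ℕ) : 𝓞 K) ∈ 𝔭'.asIdeal → 𝔭' ≠ 𝔭 →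
        ∀ (ι' : PadicAlgCl p ≃+* ℂ), SchneiderFree.BranchInducesPrime p ι' 𝔭 →
        ∀ (ΩK : ℂ) (Ωp : ℂ_[p]) (Q : PowerSeries (PadicComplexInt p)), ΩK ≠ 0 → Ωp ≠ 0 →
          R1.IsBDPLFunctionInt p ι' 𝔭 κ γ Dt.f ΩK Ωp Q →
          (XAc.charIdeal (W.baseChange K) p κ 𝔭' ∅ γ).map (PowerSeries.map (R1.toCpInt p)) = Ideal.span {Q})
    (hTw : ∀ (W : WeierstrassCurve ℚ) [W.IsElliptic] [W.IsGloballyMinimal] (N : ℕ) [NeZero N] (K : Type) [Field K]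
      [NumberField K] (Wd : WeierstrassCurve ℚ) [Wd.IsElliptic] [Wd.IsGloballyMinimal],
      R W → (ClassO5 W p ∨ ClassO6 W p) → W.HasIrreducibleModPGaloisRep p → W.analyticRank = 1 → W.conductorNorm ℤ = N →
      IsImaginaryQuadratic K → SatisfiesHeegnerHypothesis N K →
      (∃ C : VariableChange ℚ, C • W.quadraticTwist (NumberField.discr K : ℚ) = Wd) →
      (W.quadraticTwist (NumberField.discr K : ℚ)).entireLFunction 1 ≠ 0 → BSDp Wd p) :
    ∀ (W : WeierstrassCurve ℚ) [W.IsElliptic] [W.IsGloballyMinimal],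
      R W → (ClassO5 W p ∨ ClassO6 W p) → W.HasIrreducibleModPGaloisRep p → W.analyticRank = 1 → MissingPPartAt W p := by
  intro W _ _ hR hcls hirr hr
  have hGZK : rank_eq_analyticRank_of_analyticRank_le_one := hF.2.2.1
  haveI : Finite W.sha := (hGZK W (by omega)).2
  exact missingPPartAt_of_bsdp W p
    (bsdp_potSS_of_flatIMCEq_of_twist_of_facts p R hA hL hF hPT hPT2 hEP hcd hBr hBr2 hS hEq hTw W hR hcls hirr hr)

/-- **KT's residual `TameRankOne` (stmt-BirchSwinnertonDyer-19984) on the X4 rows, modulo the ♭-IMC equality and the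
rank-zero twists**: in the item's own binders (`r_an = 1 → p ≠ 2 → Addv W p → SubTprime W p`), with `ρ̄_{E,p}` irreducible
and the row predicate `R` added, `MissingPPartAt W p` follows from the hypotheses of §1 — `(t′) ⊆ O5`
(`SubTameSS := SubGss ∨ SubTprime`). CONDITIONAL; closes nothing (the residual is declared open-problem; this is its reduction
to ONE analytic statement + the r = 0 leaf on the X4 rows). [cite: JetchevSkinnerWan2017, §7.4.1 (arXiv:1512.06894 p. 30)]
[cite: Serre1967GroupesPDivisibles, §5 Prop. 8] -/
theorem missingPPartAt_tameRankOne_of_flatIMCEq_of_twist_of_facts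
    (hA : Hsieh2014.thmA_exists_isHsiehLFunction_unrPeriod_anyLevel)
    (hL : LiuZhangZhang2018.thm151_thm153_modularCurve_heegnerVector_additive)
    (hF : ToricPublishedInputs)
    (hPT : ∀ (K : Type) [Field K] [NumberField K], poitouTate_selmerStructure_duality K)
    (hPT2 : ∀ (K : Type) [Field K] [NumberField K], poitouTate_sha_tateDual K)
    (hEP : ∀ (K : Type) [Field K] [NumberField K] (v : HeightOneSpectrum (𝓞 K)),
      localEulerPoincareCharacteristic (v.adicCompletion K))
    (hcd : fieldCdLE_two_of_numberField)
    (hBr : ∀ (K : Type) [Field K] [NumberField K] (p : ℕ) [Fact p.Prime],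
      ZpExtension.decomp_not_le_kerSubgroup_of_isAnticyclotomic K p)
    (hBr2 : ∀ (K : Type) [Field K] [NumberField K] (p : ℕ) [Fact p.Prime],
      ZpExtension.decomp_not_le_kerSubgroup_above_of_isAnticyclotomic K p)
    (hS : Serre1967.noStableDivisibleLine_of_potentiallySupersingular)
    (hEq : ∀ (W : WeierstrassCurve ℚ) [W.IsElliptic] [W.IsGloballyMinimal] (N : ℕ) [NeZero N] (K : Type) [Field K]
      [NumberField K] (Dt : ModularParametrizationData W N),
      R W → (ClassO5 W p ∨ ClassO6 W p) → W.HasIrreducibleModPGaloisRep p → W.analyticRank = 1 → W.conductorNorm ℤ = N →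
      IsImaginaryQuadratic K → SatisfiesHeegnerHypothesis N K →
      ∀ (κ : ZpExtension K p), κ.IsAnticyclotomic → ∀ (γ : Field.absoluteGaloisGroup K) [Fact (κ.IsTopGenerator γ)]
        (𝔭 : HeightOneSpectrum (𝓞 K)), ((p : ℕ) : 𝓞 K) ∈ 𝔭.asIdeal → 𝔭.asIdeal.ramificationIdx (𝓞 ℚ) = 1 →
        𝔭.asIdeal.inertiaDeg (𝓞 ℚ) = 1 → ∀ (𝔭' : HeightOneSpectrum (𝓞 K)), ((p : ℕ) : 𝓞 K) ∈ 𝔭'.asIdeal → 𝔭' ≠ 𝔭 →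
        ∀ (ι' : PadicAlgCl p ≃+* ℂ), SchneiderFree.BranchInducesPrime p ι' 𝔭 →
        ∀ (ΩK : ℂ) (Ωp : ℂ_[p]) (Q : PowerSeries (PadicComplexInt p)), ΩK ≠ 0 → Ωp ≠ 0 →
          R1.IsBDPLFunctionInt p ι' 𝔭 κ γ Dt.f ΩK Ωp Q →
          (XAc.charIdeal (W.baseChange K) p κ 𝔭' ∅ γ).map (PowerSeries.map (R1.toCpInt p)) = Ideal.span {Q})
    (hTw : ∀ (W : WeierstrassCurve ℚ) [W.IsElliptic] [W.IsGloballyMinimal] (N : ℕ) [NeZero N] (K : Type) [Field K]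
      [NumberField K] (Wd : WeierstrassCurve ℚ) [Wd.IsElliptic] [Wd.IsGloballyMinimal],
      R W → (ClassO5 W p ∨ ClassO6 W p) → W.HasIrreducibleModPGaloisRep p → W.analyticRank = 1 → W.conductorNorm ℤ = N →
      IsImaginaryQuadratic K → SatisfiesHeegnerHypothesis N K →
      (∃ C : VariableChange ℚ, C • W.quadraticTwist (NumberField.discr K : ℚ) = Wd) →
      (W.quadraticTwist (NumberField.discr K : ℚ)).entireLFunction 1 ≠ 0 → BSDp Wd p) :
    ∀ (W : WeierstrassCurve ℚ) [W.IsElliptic] [W.IsGloballyMinimal], W.analyticRank = 1 → p ≠ 2 → Addv W p →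
      SubTprime W p → W.HasIrreducibleModPGaloisRep p → R W → MissingPPartAt W p := by
  intro W _ _ hr hp2 hadd hT hirr hR
  exact missingPPartAt_potSS_of_flatIMCEq_of_twist_of_facts p R hA hL hF hPT hPT2 hEP hcd hBr hBr2 hS hEq hTw W hR
    (Or.inl ⟨hp2, hadd, Or.inr hT⟩) hirr hr

end PotSS

/-- **K9's residual `WildRankOne` (stmt-BirchSwinnertonDyer-19200) on the X4 rows, modulo the ♭-IMC equality and the
rank-zero twists**: in the item's own binders (`r_an = 1 → ClassO6 W 3`), with `ρ̄_{E,3}` irreducible and the row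
predicate `R` added, `MissingPPartAt W 3` follows from the hypotheses of §1 at `p = 3`. CONDITIONAL; closes nothing.
[cite: JetchevSkinnerWan2017, §7.4.1 (arXiv:1512.06894 p. 30)] [cite: Serre1967GroupesPDivisibles, §5 Prop. 8] -/
theorem missingPPartAt_wildRankOne_of_flatIMCEq_of_twist_of_facts [Fact (3 : ℕ).Prime] (R : WeierstrassCurve ℚ → Prop)
    (hA : Hsieh2014.thmA_exists_isHsiehLFunction_unrPeriod_anyLevel)
    (hL : LiuZhangZhang2018.thm151_thm153_modularCurve_heegnerVector_additive)
    (hF : ToricPublishedInputs)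
    (hPT : ∀ (K : Type) [Field K] [NumberField K], poitouTate_selmerStructure_duality K)
    (hPT2 : ∀ (K : Type) [Field K] [NumberField K], poitouTate_sha_tateDual K)
    (hEP : ∀ (K : Type) [Field K] [NumberField K] (v : HeightOneSpectrum (𝓞 K)),
      localEulerPoincareCharacteristic (v.adicCompletion K))
    (hcd : fieldCdLE_two_of_numberField)
    (hBr : ∀ (K : Type) [Field K] [NumberField K] (p : ℕ) [Fact p.Prime],
      ZpExtension.decomp_not_le_kerSubgroup_of_isAnticyclotomic K p)
    (hBr2 : ∀ (K : Type) [Field K] [NumberField K] (p : ℕ) [Fact p.Prime],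
      ZpExtension.decomp_not_le_kerSubgroup_above_of_isAnticyclotomic K p)
    (hS : Serre1967.noStableDivisibleLine_of_potentiallySupersingular)
    (hEq : ∀ (W : WeierstrassCurve ℚ) [W.IsElliptic] [W.IsGloballyMinimal] (N : ℕ) [NeZero N] (K : Type) [Field K]
      [NumberField K] (Dt : ModularParametrizationData W N),
      R W → (ClassO5 W 3 ∨ ClassO6 W 3) → W.HasIrreducibleModPGaloisRep 3 → W.analyticRank = 1 → W.conductorNorm ℤ = N →
      IsImaginaryQuadratic K → SatisfiesHeegnerHypothesis N K →
      ∀ (κ : ZpExtension K 3), κ.IsAnticyclotomic → ∀ (γ : Field.absoluteGaloisGroup K) [Fact (κ.IsTopGenerator γ)]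
        (𝔭 : HeightOneSpectrum (𝓞 K)), ((3 : ℕ) : 𝓞 K) ∈ 𝔭.asIdeal → 𝔭.asIdeal.ramificationIdx (𝓞 ℚ) = 1 →
        𝔭.asIdeal.inertiaDeg (𝓞 ℚ) = 1 → ∀ (𝔭' : HeightOneSpectrum (𝓞 K)), ((3 : ℕ) : 𝓞 K) ∈ 𝔭'.asIdeal → 𝔭' ≠ 𝔭 →
        ∀ (ι' : PadicAlgCl 3 ≃+* ℂ), SchneiderFree.BranchInducesPrime 3 ι' 𝔭 →
        ∀ (ΩK : ℂ) (Ωp : ℂ_[3]) (Q : PowerSeries (PadicComplexInt 3)), ΩK ≠ 0 → Ωp ≠ 0 →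
          R1.IsBDPLFunctionInt 3 ι' 𝔭 κ γ Dt.f ΩK Ωp Q →
          (XAc.charIdeal (W.baseChange K) 3 κ 𝔭' ∅ γ).map (PowerSeries.map (R1.toCpInt 3)) = Ideal.span {Q})
    (hTw : ∀ (W : WeierstrassCurve ℚ) [W.IsElliptic] [W.IsGloballyMinimal] (N : ℕ) [NeZero N] (K : Type) [Field K]
      [NumberField K] (Wd : WeierstrassCurve ℚ) [Wd.IsElliptic] [Wd.IsGloballyMinimal],
      R W → (ClassO5 W 3 ∨ ClassO6 W 3) → W.HasIrreducibleModPGaloisRep 3 → W.analyticRank = 1 → W.conductorNorm ℤ = N →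
      IsImaginaryQuadratic K → SatisfiesHeegnerHypothesis N K →
      (∃ C : VariableChange ℚ, C • W.quadraticTwist (NumberField.discr K : ℚ) = Wd) →
      (W.quadraticTwist (NumberField.discr K : ℚ)).entireLFunction 1 ≠ 0 → BSDp Wd 3) :
    ∀ (W : WeierstrassCurve ℚ) [W.IsElliptic] [W.IsGloballyMinimal], W.analyticRank = 1 → ClassO6 W 3 →
      W.HasIrreducibleModPGaloisRep 3 → R W → MissingPPartAt W 3 := by
  intro W _ _ hr hO6 hirr hR
  exact missingPPartAt_potSS_of_flatIMCEq_of_twist_of_facts 3 R hA hL hF hPT hPT2 hEP hcd hBr hBr2 hS hEq hTw W hR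
    (Or.inr hO6) hirr hr

end Summit.BirchSwinnertonDyer.BirchSwinnertonDyer.Theorems.UniversalToricDescentWaldspurgerFlat

end
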